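import Mathlib
import HarnessLib
import Summits.NavierStokesRegularity.NavierStokesRegularity.Theorems.AxisTwistDoorAveragedConeLiouvilleAxisLift
import Summits.NavierStokesRegularity.NavierStokesRegularity.Theorems.HalfSpaceWindowDoorCirculationCarryingRigidityDefs

/-!
# Route `HalfSpaceWindowDoor`, crux `CirculationCarryingRigidity` (stmt-NavierStokesRegularity-25311) — TIGHTNESS of the
# eddy-torque census theorems: the swirl (sub)solution Liouville theorem FAILS when the slaving of the source to `∂ᵣf` is
# replaced by the natural SIZE bound of the eddy torque (an explicit collapsing-circulation witness)

Line `eddy_torque` (LEAD ns-hsw-p1 g5), census bookkeeping.  The landed Liouville theorems for the disc circulation `F = Γ/2π`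
(`…SourcedSwirlLiouville.nonpos`, two-sided; `…SubSwirlLiouville.nonpos`, one-sided) need the source of the circle law — the
eddy torque `ℛ` — to be SLAVED to the mean vertical vorticity, `ℛ ≤ A/(r+√(−s))·∮ω₃ dl = a·∂ᵣΓ`.  In the axis-Type-I class the
eddy torque is a priori only of the scale-invariant SIZE `|ℛ|/2π ≲ D K/(−s)` (`‖v‖ ≤ D/(|x_h|+√(−s))`, `‖∇v‖ ≤ K/(−s)`).  THIS
FILE shows that size alone cannot replace slaving, at the level of the circle law:

`exists_collapsing_witness` — the explicit scalar `f(t,x) = 1 − exp(−|x_h|²/(4(−t)))` (a Burgers/Lamb–Oseen-type circulation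
profile COLLAPSING to the axis as `t ↑ 0`, radius `∼ √(−t)`) on `ℝ³ × (−∞,0)` has smooth axisymmetric slices, vanishes on the
axis, `0 ≤ f ≤ 1`, `∂ᵣf ≥ 0`, and satisfies the swirl law with ZERO drift up to a NON-NEGATIVE source of the natural size,

  `0 ≤ ∂ₜf − (Δf − (2/r)∂ᵣf) = (r²/(2t²))·exp(−r²/(4(−t))) ≤ 1/(−t)`   off the axis,

yet `f ≢ 0` (it tends to `1` away from the axis).  Hence no Liouville theorem of the KNSS type — bounded, axis-vanishing,
radially non-decreasing ancient (sub)solutions vanish — can hold under the mere size bound `0 ≤ S ≤ A/(−t)` on the source, for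
any `A ≥ 1` (indeed `A ≥ 2/e`): the residue of the census «eddy SPIN-UP not slaved to `∮ω₃`» is ESSENTIAL for every argument
that uses only the circle-averaged swirl law and the size of the eddy flux.  (The source here is `(2/(−t))·ξe^{−ξ}`,
`ξ = r²/(4(−t))`, maximal `2/(e(−t))` at the collapse radius `r = 2√(−t)`, exactly where `∂ᵣf = √ξ e^{−ξ}/√(−t)` is NOT small: the
witness violates slaving only through the RATIO `S/∂ᵣf = r/(−t)`, unbounded relative to `A·min(1/r,1/√(−t))` as `r/√(−t) → ∞`.)
Whether the Navier–Stokes structure of `ℛ` (it is the divergence of the eddy angular-momentum flux of a closed-hemisphere profile,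
not a free function) excludes such sources is exactly the open stub.

Seat ns-hsw-p1 g5 (LEAD of 25311, cell pub-ns-dss).  WHAT THIS IS NOT: not a statement about Navier–Stokes regularity; not a
counterexample to the crux or its stub (the witness is a scalar, not a Navier–Stokes profile); an explicit linear witness
delimiting the census theorems; helper `--supports` 25311.
-/

noncomputable section

-- the summit and its single sub-problem share the name (CONVENTIONS §1), as in every Theorems file
set_option linter.dupNamespace false

namespace Summit.NavierStokesRegularity.NavierStokesRegularity.Theorems.HalfSpaceWindowDoorCirculationCarryingRigiditySubSwirlTightness

open Set Function Filter Topology InnerProductSpace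
open scoped Laplacian RealInnerProductSpace ContDiff Topology
open Literature.Analysis Literature.Analysis.FluidPDE
open Summit.NavierStokesRegularity.NavierStokesRegularity.Theorems.AxisTwistDoorAveragedConeLiouvilleAxisLift
  (lift laplacian_lift gradient_lift)

/-! ### One-dimensional calculus of the profile `1 − exp(r²/(4t))`, `t < 0` -/

/-- `d/dr [r²/(4t)] = r/(2t)`. -/
theorem hasDerivAt_sq_div (t r : ℝ) : HasDerivAt (fun r' : ℝ => r' ^ 2 / (4 * t)) (r / (2 * t)) r := by
  have h := ((hasDerivAt_pow 2 r).div_const (4 * t))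
  refine h.congr_deriv ?_
  norm_num
  ring

/-- `d/dr [1 − exp(r²/(4t))] = −exp(r²/(4t))·r/(2t)`. -/
theorem hasDerivAt_profile (t r : ℝ) :
    HasDerivAt (fun r' : ℝ => 1 - Real.exp (r' ^ 2 / (4 * t))) (-(Real.exp (r ^ 2 / (4 * t)) * (r / (2 * t)))) r :=
  ((hasDerivAt_sq_div t r).exp).const_sub 1

/-- The radial derivative as a function. -/
theorem deriv_profile (t : ℝ) :
    deriv (fun r' : ℝ => 1 - Real.exp (r' ^ 2 / (4 * t))) = fun r => -(Real.exp (r ^ 2 / (4 * t)) * (r / (2 * t))) :=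
  funext fun r => (hasDerivAt_profile t r).deriv

/-- The second radial derivative: `d²/dr² [1 − exp(r²/(4t))] = −exp(r²/(4t))·(r²/(4t²) + 1/(2t))`. -/
theorem deriv_deriv_profile (t r : ℝ) :
    deriv (fun r' => deriv (fun r'' : ℝ => 1 - Real.exp (r'' ^ 2 / (4 * t))) r') r =
      -(Real.exp (r ^ 2 / (4 * t)) * (r ^ 2 / (4 * t ^ 2) + 1 / (2 * t))) := by
  rw [deriv_profile]
  have h1 : HasDerivAt (fun r' : ℝ => Real.exp (r' ^ 2 / (4 * t))) (Real.exp (r ^ 2 / (4 * t)) * (r / (2 * t))) r :=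
    (hasDerivAt_sq_div t r).exp
  have h2 : HasDerivAt (fun r' : ℝ => r' / (2 * t)) (1 / (2 * t)) r := (hasDerivAt_id r).div_const (2 * t)
  have h := (h1.mul h2).neg
  refine h.deriv.trans ?_
  rcases eq_or_ne t 0 with ht | ht
  · simp [ht]
  · field_simp
    ring

/-- `d/dt [1 − exp(r²/(4t))] = exp(r²/(4t))·r²/(4t²)` at `t ≠ 0`. -/
theorem hasDerivAt_profile_time {t : ℝ} (ht : t ≠ 0) (r : ℝ) :
    HasDerivAt (fun σ : ℝ => 1 - Real.exp (r ^ 2 / (4 * σ))) (Real.exp (r ^ 2 / (4 * t)) * (r ^ 2 / (4 * t ^ 2))) t := by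
  have h0 : HasDerivAt (fun σ : ℝ => 4 * σ) 4 t := by simpa using (hasDerivAt_id t).const_mul 4
  have h1 : HasDerivAt (fun σ : ℝ => r ^ 2 / (4 * σ)) (-(r ^ 2 * 4) / (4 * t) ^ 2) t :=
    (hasDerivAt_const t (r ^ 2)).div h0 (by positivity) |>.congr_deriv (by ring)
  have h2 := (h1.exp).const_sub 1
  refine h2.congr_deriv ?_
  ring

/-! ### The witness -/

/-- The meridian profile `Γ(r,z,t) = 1 − exp(r²/(4t))` is `C²` (indeed smooth) on `{t < 0}`. -/
theorem contDiffOn_profile :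
    ContDiffOn ℝ 2 (fun q : ℝ × ℝ × ℝ => 1 - Real.exp (q.1 ^ 2 / (4 * q.2.2))) {q | q.2.2 < 0} := by
  refine contDiffOn_const.sub (ContDiffOn.exp (ContDiffOn.div ?_ ?_ fun q hq => ?_))
  · exact (contDiff_fst.pow 2).contDiffOn
  · exact (contDiff_const.mul (contDiff_snd.comp contDiff_snd)).contDiffOn
  · have : q.2.2 < 0 := hq
    show 4 * q.2.2 ≠ 0
    linarith

/-- The witness `f(t,x) = 1 − exp(|x_h|²/(4t))` is the axisymmetric lift of the meridian profile. -/
theorem witness_eq_lift (t : ℝ) :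
    (fun x : EuclideanSpace ℝ (Fin 3) => 1 - Real.exp ((x 0 ^ 2 + x 1 ^ 2) / (4 * t))) =
      lift (fun r _ σ => 1 - Real.exp (r ^ 2 / (4 * σ))) t := by
  funext x
  simp only [lift, cylRadius_sq]

/-- Smoothness of the slices. -/
theorem contDiff_witness (t : ℝ) :
    ContDiff ℝ (⊤ : ℕ∞) (fun x : EuclideanSpace ℝ (Fin 3) => 1 - Real.exp ((x 0 ^ 2 + x 1 ^ 2) / (4 * t))) := by
  have h0 : ContDiff ℝ (⊤ : ℕ∞) fun x : EuclideanSpace ℝ (Fin 3) => x 0 :=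
    contDiff_piLp_apply (𝕜 := ℝ) (p := 2) (E := fun _ : Fin 3 => ℝ) (i := 0)
  have h1 : ContDiff ℝ (⊤ : ℕ∞) fun x : EuclideanSpace ℝ (Fin 3) => x 1 :=
    contDiff_piLp_apply (𝕜 := ℝ) (p := 2) (E := fun _ : Fin 3 => ℝ) (i := 1)
  exact contDiff_const.sub (((h0.pow 2).add (h1.pow 2)).div_const (4 * t)).exp

/-- **THE COLLAPSING-CIRCULATION WITNESS.**  On `ℝ³ × (−∞, 0)` the scalar `f(t,x) = 1 − exp(−|x_h|²/(4(−t)))` has smooth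
axisymmetric slices, vanishes on the axis, satisfies `0 ≤ f ≤ 1` and `∂ᵣf ≥ 0`, solves the swirl law with zero drift up to a
NON-NEGATIVE source of the natural scale-invariant size, `0 ≤ ∂ₜf − (Δf − (2/r)∂ᵣf) ≤ 1/(−t)` off the axis, and is not
identically zero.  So the swirl (sub)solution Liouville theorems (`…SourcedSwirlLiouville`, `…SubSwirlLiouville`) are FALSE with
the slaving `S ≤ A·min(1/r,1/√(τ−t))·∂ᵣf` replaced by the size bound `0 ≤ S ≤ A/(τ−t)` (any `A ≥ 1`). -/
theorem exists_collapsing_witness :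
    ∃ f : ℝ → EuclideanSpace ℝ (Fin 3) → ℝ,
      (∀ t < 0, ContDiff ℝ (⊤ : ℕ∞) (f t)) ∧
      (∀ t < 0, IsAxisymmetricScalar (f t)) ∧
      (∀ t < 0, ∀ x, cylRadius x = 0 → f t x = 0) ∧
      (∀ t < 0, ∀ x, 0 ≤ f t x ∧ f t x ≤ 1) ∧
      (∀ t < 0, ∀ x, 0 ≤ fderiv ℝ (f t) x (eR x)) ∧
      (∀ t < 0, ∀ x, cylRadius x ≠ 0 →
        0 ≤ deriv (fun σ => f σ x) t - ((Δ (f t)) x - 2 / cylRadius x * fderiv ℝ (f t) x (eR x)) ∧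
        deriv (fun σ => f σ x) t - ((Δ (f t)) x - 2 / cylRadius x * fderiv ℝ (f t) x (eR x)) ≤ 1 / (0 - t)) ∧
      (∃ t < 0, ∃ x, f t x ≠ 0) := by
  set Γ : ℝ → ℝ → ℝ → ℝ := fun r _ σ => 1 - Real.exp (r ^ 2 / (4 * σ)) with hΓ
  have hΓ2 : ContDiffOn ℝ 2 (fun q : ℝ × ℝ × ℝ => Γ q.1 q.2.1 q.2.2) {q | q.2.2 < 0} := contDiffOn_profile
  refine ⟨fun t x => 1 - Real.exp ((x 0 ^ 2 + x 1 ^ 2) / (4 * t)), fun t _ => contDiff_witness t, ?_, ?_, ?_, ?_, ?_, ?_⟩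
  · -- axisymmetric
    intro t _ θ x
    show 1 - Real.exp (((rotZ θ x) 0 ^ 2 + (rotZ θ x) 1 ^ 2) / (4 * t)) = 1 - Real.exp ((x 0 ^ 2 + x 1 ^ 2) / (4 * t))
    rw [← cylRadius_sq, ← cylRadius_sq, cylRadius_rotZ]
  · -- zero on the axis
    intro t _ x hx
    show 1 - Real.exp ((x 0 ^ 2 + x 1 ^ 2) / (4 * t)) = 0
    rw [← cylRadius_sq, hx]; simp
  · -- `0 ≤ f ≤ 1`
    intro t ht x
    have harg : (x 0 ^ 2 + x 1 ^ 2) / (4 * t) ≤ 0 := div_nonpos_of_nonneg_of_nonpos (by positivity) (by linarith)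
    have h1 : Real.exp ((x 0 ^ 2 + x 1 ^ 2) / (4 * t)) ≤ 1 := Real.exp_le_one_iff.2 harg
    have h2 : 0 < Real.exp ((x 0 ^ 2 + x 1 ^ 2) / (4 * t)) := Real.exp_pos _
    exact ⟨by show 0 ≤ 1 - Real.exp _ ; linarith, by show 1 - Real.exp _ ≤ 1; linarith⟩
  · -- `∂ᵣf ≥ 0`
    intro t ht x
    by_cases hx : cylRadius x = 0
    · have : eR x = 0 := by simp [eR, hx]
      rw [this, map_zero]
    have hgrad := gradient_lift hΓ2 ht hx
    show 0 ≤ fderiv ℝ (fun x : EuclideanSpace ℝ (Fin 3) => 1 - Real.exp ((x 0 ^ 2 + x 1 ^ 2) / (4 * t))) x (eR x)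
    rw [witness_eq_lift t]
    rw [show fderiv ℝ (lift Γ t) x (eR x) = ⟪gradient (lift Γ t) x, eR x⟫_ℝ by
      rw [gradient, InnerProductSpace.toDual_symm_apply]]
    rw [hgrad, inner_add_left, real_inner_smul_left, real_inner_smul_left, inner_eR_self hx, real_inner_comm, inner_eR_eZ,
      mul_zero, add_zero, mul_one]
    show 0 ≤ deriv (fun r' => 1 - Real.exp (r' ^ 2 / (4 * t))) (cylRadius x)
    rw [(hasDerivAt_profile t (cylRadius x)).deriv]
    have hr := cylRadius_nonneg x
    have : cylRadius x / (2 * t) ≤ 0 := div_nonpos_of_nonneg_of_nonpos hr (by linarith)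
    nlinarith [Real.exp_pos (cylRadius x ^ 2 / (4 * t))]
  · -- the source: `∂ₜf − (Δf − (2/r)∂ᵣf) = exp(r²/(4t))·r²/(2t²) ∈ [0, 1/(−t)]`
    intro t ht x hx
    have ht0 : t ≠ 0 := ht.ne
    have hr : 0 < cylRadius x := lt_of_le_of_ne (cylRadius_nonneg x) (Ne.symm hx)
    set r : ℝ := cylRadius x with hrdef
    set E : ℝ := Real.exp (r ^ 2 / (4 * t)) with hE
    have hEpos : 0 < E := Real.exp_pos _
    -- time derivative
    have hdt : deriv (fun σ => 1 - Real.exp ((x 0 ^ 2 + x 1 ^ 2) / (4 * σ))) t = E * (r ^ 2 / (4 * t ^ 2)) := by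
      rw [← cylRadius_sq]
      exact (hasDerivAt_profile_time ht0 r).deriv
    -- Laplacian and radial derivative through the lift
    have hΔ : (Δ (fun x : EuclideanSpace ℝ (Fin 3) => 1 - Real.exp ((x 0 ^ 2 + x 1 ^ 2) / (4 * t)))) x =
        -(E * (r ^ 2 / (4 * t ^ 2) + 1 / (2 * t))) + r⁻¹ * (-(E * (r / (2 * t)))) + 0 := by
      rw [witness_eq_lift t, laplacian_lift hΓ2 ht hx]
      show deriv (fun r' => deriv (fun r'' => 1 - Real.exp (r'' ^ 2 / (4 * t))) r') r +
          r⁻¹ * deriv (fun r' => 1 - Real.exp (r' ^ 2 / (4 * t))) r +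
          deriv (fun z' => deriv (fun _ : ℝ => 1 - Real.exp (r ^ 2 / (4 * t))) z') (x 2) = _
      rw [deriv_deriv_profile, (hasDerivAt_profile t r).deriv]
      simp [hE]
    have hR : fderiv ℝ (fun x : EuclideanSpace ℝ (Fin 3) => 1 - Real.exp ((x 0 ^ 2 + x 1 ^ 2) / (4 * t))) x (eR x) =
        -(E * (r / (2 * t))) := by
      rw [witness_eq_lift t]
      rw [show fderiv ℝ (lift Γ t) x (eR x) = ⟪gradient (lift Γ t) x, eR x⟫_ℝ by
        rw [gradient, InnerProductSpace.toDual_symm_apply]]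
      rw [gradient_lift hΓ2 ht hx, inner_add_left, real_inner_smul_left, real_inner_smul_left, inner_eR_self hx,
        real_inner_comm, inner_eR_eZ, mul_zero, add_zero, mul_one]
      exact (hasDerivAt_profile t r).deriv
    have hsrc : deriv (fun σ => 1 - Real.exp ((x 0 ^ 2 + x 1 ^ 2) / (4 * σ))) t -
        ((Δ (fun x : EuclideanSpace ℝ (Fin 3) => 1 - Real.exp ((x 0 ^ 2 + x 1 ^ 2) / (4 * t)))) x -
          2 / cylRadius x * fderiv ℝ (fun x : EuclideanSpace ℝ (Fin 3) => 1 - Real.exp ((x 0 ^ 2 + x 1 ^ 2) / (4 * t))) x (eR x)) =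
        E * (r ^ 2 / (2 * t ^ 2)) := by
      rw [hdt, hΔ, hR, ← hrdef]
      field_simp
      ring
    show 0 ≤ deriv (fun σ => 1 - Real.exp ((x 0 ^ 2 + x 1 ^ 2) / (4 * σ))) t - _ ∧
      deriv (fun σ => 1 - Real.exp ((x 0 ^ 2 + x 1 ^ 2) / (4 * σ))) t - _ ≤ 1 / (0 - t)
    rw [hsrc]
    refine ⟨by positivity, ?_⟩
    -- `ξ e^{−ξ} ≤ 1/e ≤ 1/2` with `ξ = r²/(4(−t))`
    have hτ : 0 < -t := by linarith
    set ξ : ℝ := r ^ 2 / (4 * (-t)) with hξ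
    have hξ0 : 0 ≤ ξ := by positivity
    have hEξ : E = Real.exp (-ξ) := by rw [hE, hξ]; congr 1; field_simp
    have hkey : ξ * Real.exp (-ξ) ≤ 1 / 2 := by
      -- `ξ + 1 ≤ e^ξ` ⇒ `ξ e^{-ξ} ≤ (e^ξ - 1) e^{-ξ} = 1 - e^{-ξ} ≤ 1`… sharper: `2ξ ≤ e^ξ` from `e^ξ ≥ 1 + ξ + ξ²/2 ≥ 2ξ`
      have h1 : 2 * ξ ≤ Real.exp ξ := by
        have := Real.quadratic_le_exp_of_nonneg hξ0
        nlinarith [sq_nonneg (ξ - 1)]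
      have h2 : Real.exp ξ * Real.exp (-ξ) = 1 := by rw [← Real.exp_add, add_neg_cancel, Real.exp_zero]
      nlinarith [Real.exp_pos (-ξ)]
    have e1 : E * (r ^ 2 / (2 * t ^ 2)) = (2 / (-t)) * (ξ * Real.exp (-ξ)) := by
      rw [hEξ, hξ]; field_simp; ring
    rw [e1, zero_sub, show 1 / -t = (2 / (-t)) * (1 / 2) by field_simp]
    exact mul_le_mul_of_nonneg_left hkey (by positivity)
  · -- not identically zero: `f(−1, e₀) = 1 − e^{−1/4} ≠ 0`
    refine ⟨-1, by norm_num, EuclideanSpace.single (0 : Fin 3) (1 : ℝ), ?_⟩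
    show 1 - Real.exp (((EuclideanSpace.single (0 : Fin 3) (1 : ℝ)) 0 ^ 2 +
      (EuclideanSpace.single (0 : Fin 3) (1 : ℝ)) 1 ^ 2) / (4 * (-1))) ≠ 0
    have h : Real.exp (((EuclideanSpace.single (0 : Fin 3) (1 : ℝ)) 0 ^ 2 +
        (EuclideanSpace.single (0 : Fin 3) (1 : ℝ)) 1 ^ 2) / (4 * (-1))) < 1 := by
      rw [Real.exp_lt_one_iff]
      simp
    linarith

end Summit.NavierStokesRegularity.NavierStokesRegularity.Theorems.HalfSpaceWindowDoorCirculationCarryingRigiditySubSwirlTightness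

end
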